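import Literature.NumberTheory.EllipticCurves.CuspFormLFunction
import HarnessLib

/-!
# The Hecke polynomial of a weight-two newform has simple roots at every prime not dividing the level
# (Coleman–Edixhoven 1998, Thm. 2.1)

Topic `NumberTheory/EllipticCurves`; namespace `Literature.NumberTheory.EllipticCurves`.  ONE named fact
(`def … : Prop`, nothing asserted, nothing admitted) + its `Iff.rfl` unfolding lemma + two PROVED readings,
typed for the `bsd-addord` cell (work item `wi-76860`, residual (R2b) of
`Summit.BirchSwinnertonDyer.BirchSwinnertonDyer.Theorems.KimAtThreeDeepLowerOffStratumLevelLoweringVatsalStabRows`,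
W2 road (b)): Vatsal's Condition 1 (`HasSimpleHeckeGenEigenspace`,
`Literature/NumberTheory/EllipticCurves/CanonicalPeriodSymbolCongruence.lean`) for the `q`-stabilisation
`g_α ∈ S₂(Γ₀(Mq))` of a level-lowered newform `g ∈ S₂(Γ₀(M))`, `q ∤ M`, needs `U_q` semisimple on the `q`-old
plane `⟨g(z), g(qz)⟩`, i.e. `α ≠ β` for the two roots of `x² − a_q(g)x + q` — which is exactly the printed
theorem at the prime `q ∤ M` (the coefficient `a_q(g)` lives in the number field `K_g`, which may contain `√q`,
so this is NOT the integer remark `a_q² ≠ 4q` available for a rational elliptic curve).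

PRINT (verbatim, [ColemanEdixhoven1998] §2, Theorem 2.1 — «An elementary proof in the case of weight two»):
*"Let f = ∑ aₙqⁿ be a cuspidal normalized eigenform of weight two, some level N and character
ε : (ℤ/Nℤ)* → ℂ*. Let p be a prime number not dividing N. Then the polynomial x² − a_p x + ε(p)p has simple
roots."*  The printed proof is unconditional and short (the abelian variety `A_f = 𝒪_K ⊗_𝕋 J₁(N)/I_f J₁(N)`,
the Eichler–Shimura congruence relation `Frob_p² − a_p Frob_p + ε(p)p = 0` in `End(A_{𝔽_p})`, semisimplicity
of Frobenius on abelian varieties over `𝔽_p`, and the action of a double root `λ` (`λ² = ε(p)p`) on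
`H⁰(A_{𝔽_p}, Ω¹) = 𝔽_p ⊗ Fil¹H¹_dR`); §3 (Thm. 3.1) is the weight `k ≥ 3` analogue CONDITIONAL on the
semisimplicity of crystalline Frobenius, §4 the applications: Thm. 4.1 *"Then we have |a_p| < 2p^{(k−1)/2}"*
(strict Ramanujan–Deligne, unconditional for `k = 2`) and Thm. 4.2 (`T_p` semisimple on `S_k(Γ₁(N))` when
`p³ ∤ N`; unconditional for `k = 2`).

TYPING (tree currency, the special case the consumer reads): trivial character, `Γ₀(M)`, a NEWFORM
`g : CuspForm (Gamma0 M) 2` (`IsNewform0 g`: new, Hecke eigenform, normalised — print needs only «cuspidal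
normalized eigenform», so the typed hypothesis is STRONGER than print's and the fact is the corresponding
special case), coefficients `cuspCoeff g n` (`Literature/NumberTheory/EllipticCurves/CuspFormLFunction.lean`);
«`x² − a_q x + q` has simple roots» over `ℂ` ⟺ its discriminant `a_q² − 4q` is non-zero ⟺ `a_q² ≠ 4q`
(the private `simpleRoots_of_sq_ne` below proves the reading `α + β = a_q ∧ αβ = q ⟹ α ≠ β` from it).
-- TODO(general form): arbitrary level-`N` character `ε` (`x² − a_p x + ε(p)p`, forms on `Γ₁(N)`), and the
-- conditional weight-`k ≥ 3` statement of Thm. 3.1; neither has a consumer in the tree today.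

## References

* R. F. Coleman, B. Edixhoven, *On the semi-simplicity of the U_p-operator on modular forms*, Math. Ann. 310
  (1998) 119–127 (arXiv:alg-geom/9611013), §2 Thm. 2.1; §4 Thms. 4.1, 4.2. [ColemanEdixhoven1998]
* V. Vatsal, *Canonical periods and congruence formulae*, Duke Math. J. 98 (1999), (1.2) Condition 1. [Vatsal1999]
-/

noncomputable section

open scoped MatrixGroups ModularForm

open CongruenceSubgroup Literature.NumberTheory.EllipticCurves.ModularForms

namespace Literature.NumberTheory.EllipticCurves

/-- **Coleman–Edixhoven 1998, Thm. 2.1, for newforms on `Γ₀(M)` (trivial character)**: for a newform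
`g ∈ S₂(Γ₀(M))` and a prime `q ∤ M`, the Hecke polynomial `x² − a_q(g)x + q` has SIMPLE roots, i.e. its
discriminant does not vanish: `a_q(g)² ≠ 4q`.  Print: *"Let f = ∑ aₙqⁿ be a cuspidal normalized eigenform of
weight two, some level N and character ε : (ℤ/Nℤ)* → ℂ*. Let p be a prime number not dividing N. Then the
polynomial x² − a_p x + ε(p)p has simple roots."* (here `ε = 1`; hypothesis `IsNewform0` ⊇ print's «cuspidal
normalized eigenform»). Nothing is asserted: this is a `Prop`-valued definition consumed as a hypothesis.
[cite: ColemanEdixhoven1998, Thm. 2.1] -/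
def colemanEdixhoven1998_heckePolynomial_simpleRoots : Prop :=
  ∀ {M : ℕ} [NeZero M] (g : CuspForm (Gamma0 M) 2), IsNewform0 g →
    ∀ q : ℕ, q.Prime → ¬ q ∣ M → cuspCoeff g q ^ 2 ≠ 4 * (q : ℂ)

/-- Unfolding lemma (the fact is a `Prop`-valued definition; this is its statement).
[cite: ColemanEdixhoven1998, Thm. 2.1] -/
theorem colemanEdixhoven1998_heckePolynomial_simpleRoots_iff :
    colemanEdixhoven1998_heckePolynomial_simpleRoots ↔
      ∀ {M : ℕ} [NeZero M] (g : CuspForm (Gamma0 M) 2), IsNewform0 g →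
        ∀ q : ℕ, q.Prime → ¬ q ∣ M → cuspCoeff g q ^ 2 ≠ 4 * (q : ℂ) :=
  Iff.rfl

/-- The discriminant reading: under the fact, `a_q(g)² − 4q ≠ 0` for a newform `g ∈ S₂(Γ₀(M))` and a prime
`q ∤ M`. [cite: ColemanEdixhoven1998, Thm. 2.1] -/
theorem colemanEdixhoven1998_heckePolynomial_simpleRoots.discr_ne_zero
    (h : colemanEdixhoven1998_heckePolynomial_simpleRoots) {M : ℕ} [NeZero M] {g : CuspForm (Gamma0 M) 2}
    (hg : IsNewform0 g) {q : ℕ} (hq : q.Prime) (hqM : ¬ q ∣ M) :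
    cuspCoeff g q ^ 2 - 4 * (q : ℂ) ≠ 0 :=
  sub_ne_zero.mpr (h g hg q hq hqM)

/-- «Simple roots» from the non-vanishing discriminant, over any field: if `α + β = a`, `αβ = c` and
`a² ≠ 4c`, then `α ≠ β` (because `(α − β)² = (α + β)² − 4αβ`). [folklore] -/
private theorem simpleRoots_of_sq_ne {F : Type*} [Field F] {α β a c : F} (hsum : α + β = a) (hprod : α * β = c)
    (hdisc : a ^ 2 ≠ 4 * c) : α ≠ β := by
  rintro rfl
  apply hdisc
  rw [← hsum, ← hprod]
  ring

/-- **The `α ≠ β` reading the consumer uses** (`U_q` semisimple on the `q`-old plane `⟨g(z), g(qz)⟩` of the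
`q`-stabilisation): under the fact, any factorisation `x² − a_q(g)x + q = (x − α)(x − β)` over `ℂ` — i.e.
`α + β = a_q(g)`, `αβ = q` — of the Hecke polynomial of a newform `g ∈ S₂(Γ₀(M))` at a prime `q ∤ M` has
`α ≠ β`. [cite: ColemanEdixhoven1998, Thm. 2.1] -/
theorem colemanEdixhoven1998_heckePolynomial_simpleRoots.root_ne
    (h : colemanEdixhoven1998_heckePolynomial_simpleRoots) {M : ℕ} [NeZero M] {g : CuspForm (Gamma0 M) 2}
    (hg : IsNewform0 g) {q : ℕ} (hq : q.Prime) (hqM : ¬ q ∣ M) {α β : ℂ}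
    (hsum : α + β = cuspCoeff g q) (hprod : α * β = (q : ℂ)) : α ≠ β :=
  simpleRoots_of_sq_ne hsum hprod (h g hg q hq hqM)

end Literature.NumberTheory.EllipticCurves

end
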